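import Mathlib
import HarnessLib
import HarnessLib.Audit
import Summits.QuantumAdvantage.Statement
import Literature.Computability.QuantumComplexity.PauliExpansion
import Literature.Computability.QuantumComplexity.GaussianRank
import Literature.Barriers.QuantumAdvantage.BoundedEntanglement

/-!
Route: SymplecticPurity

CLOSED (retired) 2026-08-16T14:04:28Z by planner-rchoice-QuantumAdvantage-SymplecticPur-64c96483-0 — reason: retire-with-barriers (human ruling 2026-08-16 'let the X pair go'): proven bounds filed under Literature/Barriers/QuantumAdvantage/NoFreeFrame*.lean; NoFreeFrame refutes the free-frame road — note: bounds filed as barriers (all ACCEPTED 2026-08-16): noFreeFrame — Literature/Barriers/QuantumAdvantage/NoFreeFrame.lean, p107572 (= item NoFreeFrame stmt-QuantumAdvantage-10731: ¬H_FF — the FREE-FRAME ROAD, i.e. CAMPS / Clifford-DMRG / stabilizer-TN representability of every uniform oracle-free Clif. The file is kept as the record of this route; refuted decls are indexed as negative knowledge (`ledger negatives`).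

# Route SymplecticPurity — flat Pauli spectrum forbids every free frame — CAMPS-type simulators need
exponential bonds on S-box and Shor data states

Route SymplecticPurity realises idea card
QuantumAdvantage/QuantumAdvantage/entanglement-you-cannot-rotate-away (NEGATIVE side,
Dequantize- /PauliFlat- /ShorLocallyDark-shaped). THESIS X (= item FFThesis, the target decl shared
with those routes): every language
decided with error 1/3 by a poly-time uniform oracle-free Clifford+T family is in BPP; the deciding
theorem is `closes : X → … →
¬QuantumAdvantage` (pure logic: X contradicts ∃ L ∈ BQP ∖ BPP). ROAD TO X (expected FALSE; the route
exists for its KILLS): the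
FREE-FRAME hypothesis H_FF beneath the 2024–26 hybrid dequantizers (Clifford-augmented MPS/DMRG/TDVP
= CAMPS, stabilizer tensor
networks, Clifford+matchgate DMRG: arXiv:2405.09217, 2412.17209, 2407.03202, 2501.00413, 2505.08635,
2510.04164) — every state of a
uniform family is F|φ⟩ with F a FREE frame (T-free Clifford circuit, or fermionic Gaussian unitary)
and φ of polynomial bond
dimension across every linear cut. DELIVERABLES: (i) the frame-independent purity bound (crux
SymplecticPurityBound: an ε-flat
state, with ANY stabilizer ancillas, has in EVERY Clifford frame a linear cut of purity ≤ 4ε —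
Schmidt rank ≥ 1/(4ε)); (ii) the
S-box dictionary (support GraphStateSpectrum: flatness of the data-loading state |x⟩|f(x)⟩ =
resistance of f to differential AND
linear cryptanalysis) and its almost-bent instance (crux CubeGraphFlat: x ↦ x³ on GF(2ⁿ) gives ε ≤
2√2ⁿ/2ⁿ on 2n qubits), hence the
unconditional kill ¬H_FF (support NoFreeFrame); (iii) the transfer to Shor's own data state (crux
DlogGraphFlat) and the reach of
the mechanism (cruxes GaussianDegreeBound, CompositeFrameBound).
Lean: `Literature.Computability.Cryptography.BQP ⊆ Literature.Computability.Complexity.BPP`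

## Assembly
Pure logic, as in Dequantize/PauliFlat/ShorLocallyDark: X = BQP ⊆ BPP alone contradicts the summit ∃
L ∈ BQP ∖ BPP (no BPP ⊆ BQP
needed in this direction). The deciding theorem `closes` takes every item as a hypothesis and uses
only FFThesis (three-line term,
checked sorry-free in the planner's Sketch.lean together with `assembly_holds`). The cruxes are not
in the logical chain: they are
the KILLS of the free-frame road to X.

Rationale: WHY THIS LINE. Dequantize, PauliFlat and ShorLocallyDark shoot at stabilizer rank, Pauli-coefficient
truncation and correlation-order closures; the
fourth and newest simulator family — a FREE-THEORY FRAME (Clifford or matchgate) composed with a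
tensor network — has no quantitative
obstruction in print for any explicit family (arXiv:2410.09001 proves Clifford DISentangling works
for t ≲ N T-gates and asks where
magic and entanglement become inextricable; arXiv:2602.15942 Thm III.1 is a one-qubit qualitative
no-go; arXiv:2411.11720 §6 poses
the hybrid entanglement–magic lower-bound problem). Mechanism: purity of a cut after a Clifford
frame is Pauli-spectrum mass on a
symplectic subspace (Clifford = Sp(2n,𝔽₂) on Pauli labels), after a Gaussian frame it is
Bessel-bounded inside each Majorana degree
(compound of R ∈ O(2n)); so an ℓ∞-flat Pauli spectrum forces near-maximal Rényi-2 entanglement at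
some bond of EVERY free frame, and
a stabilizer-code cleaning count (Fattal–Cubitt–Yamamoto–Bravyi–Chuang quant-ph/0406168,
Bravyi–Terhal arXiv:0810.1983) makes this
robust to arbitrarily many stabilizer ancillas (planner's addition; the card's cut-by-cut claim is
false with clean ancillas).
Imported areas: symplectic geometry over 𝔽₂ / stabilizer codes (cleaning lemma), S-box theory of
symmetric cryptography
(differential uniformity and linearity: Gold 1968, Nyberg EUROCRYPT'93, Chabaud–Vaudenay
EUROCRYPT'94 — almost-bent ⟹ APN),
exponential sums over subgroups and digits (Konyagin–Shparlinski, Bourgain–Glibichuk–Konyagin,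
Mauduit–Rivat) for the Shor transfer,
free fermions (Jozsa–Miyake arXiv:0804.4050, Terhal–DiVincenzo). New w.r.t. prior routes: a
STATE-side, frame-minimised
(representation-independent) kill currency max_{Q≠I}|⟨Q⟩| with an exact cryptographic dictionary;
PauliFlat's XorCoincidenceBound
and ShorLocallyDark's AN-code distance reappear as the provable sub-families of DlogGraphFlat; the
negatives index (1 entry,
KummerSector) is untouched. FRAMES ARE TYPED SEMANTICALLY (cone repair 2026-08-15): a Clifford frame
is any unitary U with U σ_S U† = (unit phase)·σ_{S'} for every Pauli string (items 9835/9839/9842),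
so the kills cover the whole Clifford group, do not wait for the H/S/CNOT generation theorem, and
their proofs do not ride on the undischarged gate-unitarity facts of QubitRegister; the circuit
syntax (QCircuit.mat, tCount) has left the statements.

RANKED CRUXES. #0 FFThesis (target) — X of routes Dequantize / PauliFlat / ShorLocallyDark (shared
decl): every uniform oracle-free Clifford+T family with error 1/3 decides a BPP language — here
reached (hypothetically) by free-frame tensor networks; the route exists for the kills of that road.
(why it might fail: X puts FACTORING in BPP (Shor) against the oracle evidence BQP^O ⊄ BPP^O; its
free-frame road H_FF is refuted outright on explicit uniform families (NoFreeFrame from cruxes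
2–3).) [BernsteinVazirani1997 §8, arXiv:2412.17209, arXiv:2410.09001, card
QuantumAdvantage/QuantumAdvantage/entanglement-you-cannot-rotate-away]
#2 SymplecticPurityBound (support since retriage, load-bearing) — ENTANGLEMENT YOU CANNOT ROTATE
AWAY (card P1+identity (1), made ancilla-robust). Let ψ be a unit vector on n ≥ 1 qubits with
|⟨ψ|S|ψ⟩| ≤ ε for every Pauli string S ≠ I. For every m and every CLIFFORD UNITARY U on n+m qubits
(semantic: U unitary and U σ_S U† = (unit phase)·σ_{S'} for every Pauli string S — every T-free
oracle-free Clifford+T circuit, qubit permutation and stabilizer-ancilla preparation is one), the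
state U(ψ ⊗ |0^m⟩) has a LINEAR cut {wires < k} whose reduced purity Tr ρ² (written as the 4-fold
agreement sum) is ≤ 4ε; hence Schmidt rank ≥ 1/(4ε) at that bond, in every qubit ordering
(permutations are Clifford) and for every stabilizer ancilla state (absorbed in U). Proof found at
planning (audited by four refuters, constant 3): Tr ρ_A² = 2^{-|A|} Σ_{Q∈𝒫_A}⟨Q⟩²; Q ↦ U†QU maps 𝒫_A
∩ S^⊥ (S = U(I⊗𝒵_m)U†, dim m) onto data Paulis with fibres S_A, so Tr ρ_A² ≤ 2^{-(|A|−s_A)} +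
2^{|A|−m+s_Ā}ε²; along the chain |A_k|−s_{A_k} moves by steps in {−1,0,1} from 0 to n, and at its
first passage through E = ⌈log₂ 1/ε⌉ the bound is 2^{−E} + 2^{E}ε² ≤ 3ε (numerically verified cut by
cut, compute/check_frames.py). [difficulty: M] (why it might fail: The ancilla-robust cleaning count
is the planner's (checked numerically to 12 qubits, all cuts, structured + random frames), not in
print; as typed the risks are conventions — ℂ-valued 4-fold purity sum under ‖·‖, wire order of
tensorVec, the phase c in U σ_S U† = c σ_{S'} — not the inequality.) [arXiv:quant-ph/0406168,
arXiv:0810.1983, arXiv:2412.17209, arXiv:2410.09001, arXiv:2403.19610, KempeEtAl2010,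
AaronsonGottesman2004]
#3 CubeGraphFlat (support since retriage) — THE ALMOST-BENT WITNESS (card K1 made unconditional on
an explicit family). For every finite field K with |K| = 2ⁿ and every additive (= 𝔽₂-linear)
identification e : K ≃ 𝔽₂ⁿ, the unnormalised graph vector g = Σ_x |x⟩|e((e⁻¹x)³)⟩ on n+n qubits
satisfies |⟨g|S|g⟩| ≤ 2·√2ⁿ for every Pauli string S ≠ I (i.e. the normalised data-loading state of
the cube map is 2^{1−n/2}-flat). Mechanism: by GraphStateSpectrum the bound is max(Δ, L) of f =
cube; Δ = 2 ((x+a)³+x³ = a x² + a²x + a³ is 2-to-1) and L = 2^{⌊n/2⌋+1} (|W(α,β)|² = 2ⁿ·#{u : u = 0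
∨ βu³ = …} ≤ 2^{n+2}), Gold 1968 / Nyberg 1993; checked n = 3..7 (compute/check_cube.py: D = 2, L =
4,8,8,16,16 — the bound is tight for even n). [deps: GraphStateSpectrum, CubeAlmostBent]
[difficulty: M] (why it might fail: Mathematically classical (APN/AB exponents); zero slack for even
n (L = 2^{n/2+1} = 2√2ⁿ exactly), so any convention slip (Bool↔ZMod 2 transport through e,
castAdd/natAdd register order, Y-phase signs in pauliString) shows immediately; e additive suffices
since additive = 𝔽₂-linear.) [doi:10.1109/TIT.1968.1054106, doi:10.1007/3-540-48285-7_6,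
doi:10.1007/BFb0053450, doi:10.1023/A:1008344232130, panama:326022377504858 (Carlet 2021, Boolean
Functions for Cryptography and Coding Theory, ch. 11: APN/AB, Gold exponents), arXiv:2308.01886]
#4 DlogGraphFlat (crux) — SHOR TRANSFER (card K1, hypotheses repaired; NAF guard re-typed over n+1
signed digits on 2026-08-15 after refuters g41-49 / g41-31 / rreview-0815T14-7 showed the n-digit
guard vacuous and a complement resonance ⟨X^a⊗X^{ā'}⟩ = 2^{n−1} at Mersenne p). ∃ δ > 0 ∃ n₀ ∀ n ≥
n₀: for every prime p with 2ⁿ − 2^{⌊0.53n⌋} ≤ p < 2ⁿ (Baker–Harman–Pintz window: such primes exist;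
range bias of the y-register ≤ 3·2^{0.53n}), every primitive root g mod p such that p − 1 has NO
signed-binary representation Σ_{i≤n} c_i 2^i (c_i ∈ {0,±1}, n+1 digits, i.e. true NAF weight w(p−1)
≥ n/8) of weight < n/8 (off the Pohlig–Hellman / AN-code / complement-resonance locus: Mersenne p
and p = 2ⁿ − c with bit-sparse c + 1 are excluded), the unnormalised DLOG graph vector Σ_{x<2ⁿ}
|x⟩|g^x mod p⟩ on n+n qubits has |⟨S⟩| ≤ 2^{(1−δ)n} for all Pauli strings S ≠ I. Spectrum =
XOR-differential counts #{x : g^{x⊕a} ≡ (g^x mod p) ⊕ a'} twisted by digit-Walsh phases (−1)^{b·x +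
b'·bits(g^x)}. Provable sub-families (planner): a = 0, a' ≠ 0 vanish; the complement-resonance
family S = X^a ⊗ X^{ā'} (a = supp NAF((p−1)/2), using g^{(p−1)/2} = −1 and p − y = ȳ − (t−1)) is
governed EXACTLY by NAF weights (⟨S⟩ = 2^{n−1} at Mersenne p, ≈ 2^{n+1−w(p−1)−w(s−1)} in general
with p − 1 = 2ⁿ − 2s; refuters g41-49/g41-31, planner data n ≤ 12: this and the range bias are the
two dominant families) — hence the hypothesis w(p−1) ≥ n/8 over n+1 digits (typical w ≈ 0.18n in the
window), which forces any admissible δ below 1/8; |a|+|a'| ≤ (1/2−δ)n via PauliFlat's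
XorCoincidenceBound with (c, N, u) = (g^{a−2w}, p, a'); Z⊗Z masks of weight ≤ cn/log n via
multiplicative characters × Gauss sums × ℓ1 of digital functions (≤ (Cn)^{|b|+|b'|}√p). Open: heavy
masks and long shifts. [deps: GraphStateSpectrum] [difficulty: XL] (why it might fail: Heavy digit
masks (|b|+|b'| ≫ n/log n) and long XOR shifts are beyond Gauss-sum/BGK/Mauduit–Rivat technology
(PauliFlat data: mask maxima of y ↦ ay mod N decay only like N^0.9), and a structured resonance (p−1
smooth, digit-periodic g^x) could pin some |⟨Q⟩| at 2^{−o(n)}·2ⁿ.) [isbn:9780521642637,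
doi:10.1007/978-3-0348-8037-4, BourgainGlibichukKonyagin2006, doi:10.4007/annals.2010.171.1591,
arXiv:1501.07644, route-QuantumAdvantage-PauliFlat item XorCoincidenceBound,
route-QuantumAdvantage-ShorLocallyDark item OrderSparseMultiplesRare]
#5 GaussianDegreeBound (support since retriage) — MATCHGATE FRAMES (card identity (2)). For a unit
ε-flat ψ on n qubits and every fermionic Gaussian unitary U (U c_p U† = Σ_q R_pq c_q with R Rᵀ = 1,
c = the tree's Jordan–Wigner `majorana`), every initial block of d ≤ n qubits of Uψ has purity ≤
2^{−d}(1 + ε² Σ_{k=1}^{2d} C(2n,k)): in a fixed JW frame no matchgate circuit lowers the Rényi-2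
entanglement of the first d ≤ c(δ)n qubits of a 2^{−δn}-flat state below d − 1 (H(d/n) < δ). Proof:
U†c_S U = Σ_{|T|=|S|} det(R_{T,S}) c_T (compound of an orthogonal matrix is orthogonal), Bessel
inside each degree, Tr ρ_{[d]}² = 2^{−d} Σ_{S ⊆ first 2d modes} ⟨c_S⟩². [difficulty: M] (why it
might fail: Bessel per Majorana degree; could fail only through conventions (JW order of `majorana n
j b`, star U for U⁻¹, ℂ-cast of R; parity-odd R allowed, harmless); NB with poly(n) ancilla MODES
the count degrades to Σ_j C(2n,k−2j)C(m,j), 2^{Ω(n/log n)} — not claimed here.) [arXiv:0804.4050,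
arXiv:quant-ph/0108010, arXiv:quant-ph/0404180, arXiv:2505.08635, arXiv:2410.09001, tree
Literature/Computability/QuantumComplexity/GaussianRank.lean (majorana)]
#6 CompositeFrameBound (crux) — DEPTH-3 COMPOSITE FRAMES (card K2, typed on the witness). ∃ c > 0 ∃
n₀ ∀ n ≥ n₀, every field K of order 2ⁿ and identification e, all Clifford unitaries U₁, U₂ on n+n
qubits (semantic, as in #2) and every Gaussian unitary U on n+n qubits: the state U₂ U U₁ ĝ (ĝ =
normalised cube graph state) still has a linear cut of purity ≤ 2^{−cn} —
Clifford∘matchgate∘Clifford re-framing (arXiv:2505.08635-type alternation, depth 2–3) does not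
compress the almost-bent data state either. [deps: SymplecticPurityBound, GaussianDegreeBound]
[difficulty: open-problem] (why it might fail: May be FALSE: Clifford∘Gaussian∘Clifford is no group
and no invariant is known; flatness is an ℓ∞ condition in the Pauli basis that a Gaussian rotation
smears over C(2n,k) monomials, so cruxes 2 and 5 do not iterate; one depth-2 disentangler of |x⟩|x³⟩
refutes it (informative either way).) [arXiv:2505.08635, arXiv:2602.15942, arXiv:2410.09001,
arXiv:2412.17209]
#9 GraphStateSpectrum (support) — THE S-BOX DICTIONARY (provable now, elementary; verified
exhaustively for n = 3). For f : 𝔽₂ⁿ → 𝔽₂ⁿ with differential uniformity ≤ D (∀ a ≠ 0, b: #{x :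
f(x⊕a) ⊕ f(x) = b} ≤ D) and linearity ≤ Λ (∀ β ≠ 0, α: |Σ_x (−1)^{α·x ⊕ β·f(x)}| ≤ Λ), the
unnormalised graph vector g_f = Σ_x |x⟩|f(x)⟩ has |⟨g_f|S|g_f⟩| ≤ max(D, Λ) for every Pauli string S
≠ I: a Pauli with X-part (a,a') pairs |x,f x⟩ with |x⊕a, f(x)⊕a'⟩, non-zero only when f(x⊕a) =
f(x)⊕a' (≤ D terms of modulus 1; 0 terms if a = 0 ≠ a'); a Z-type Pauli gives the Walsh sum (≤ Λ, or
0 when β = 0 ≠ α). [difficulty: provable-now] [doi:10.1007/BFb0053450, doi:10.1007/3-540-48285-7_6,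
KempeEtAl2010, arXiv:2308.01886]
#9 CubeAlmostBent (support) — GOLD/NYBERG FIELD FACTS (provable now over Mathlib): in every finite
field K of order 2ⁿ (as a ZMod 2-algebra), (i) x ↦ x³ is almost perfect nonlinear: ∀ a ≠ 0, b, #{x :
(x+a)³ + x³ = b} ≤ 2 (a x² + a² x + a³ = b is quadratic in x); (ii) its component functions are
near-bent: ∀ β ≠ 0, α, |Σ_x (−1)^{Tr(αx + βx³)}| ≤ 2√2ⁿ (square the sum, substitute y = x+u: inner
sum = 2ⁿ·[βu + β²u⁴ = 0], at most 4 values of u; trace form non-degenerate). [difficulty: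
provable-now] [doi:10.1109/TIT.1968.1054106, doi:10.1007/3-540-48285-7_6,
doi:10.1023/A:1008344232130, panama:326022377504858 (Carlet 2021, ch. 11), Mathlib Algebra.trace /
traceForm_nondegenerate]
#9 NoFreeFrame (support) — THE COMPLEXITY-LEVEL KILL ¬H_FF (provable given SymplecticPurityBound +
CubeGraphFlat + one uniform witness family). H_FF (non-uniform, weakest form: existence only, purity
form): every uniform oracle-free Clifford+T family F admits c such that for every input x and stage
j some Clifford unitary U (semantic, as in #2) on the |x| + ancillas wires gives U·(F.stateAfter x
j) purity ≥ 1/(|x|^c + c) across EVERY linear cut (⟸ bond dimension ≤ poly in some Clifford frame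
and ordering — the representability beneath CAMPS / stabilizer-TN / Clifford-DMRG). CLAIM: ¬H_FF.
Witness: F_n loads Σ_y |y⟩ (H on n fresh wires) and computes y ↦ y³ in 𝔽₂[X]/(X^{2·3^k} + X^{3^k} +
1) (n = 2·3^k; the 3^{k+1}-th cyclotomic polynomial, irreducible over 𝔽₂ since 2 is a primitive root
mod 3^{k+1}) with the tree's revCompile (Toffoli = exact Clifford+T) and uncomputed scratch; at the
final stage the state is |x⟩ ⊗ g_cube/√2ⁿ ⊗ |0…0⟩, so by cruxes 2–3 every frame has a cut of purity
≤ 8√2ⁿ/2ⁿ < 1/(n^c + c) for large n. The uniformity proof (IsUniform) rides on the tree's RevSLP /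
uniformReversibleSimulation machinery. [difficulty: XL] [arXiv:2412.17209, arXiv:2405.09217,
arXiv:2407.03202, arXiv:quant-ph/0301063, JozsaLinden2003, tree
Literature/Barriers/QuantumAdvantage/BoundedEntanglement.lean (stateAfter), tree
Literature/Computability/QuantumComplexity/ReversibleCliffordT.lean (revCompile)]

TWO-LAYER PLAN. Foreseen glued splits (filed only when a node closes or stalls):
SymplecticPurityBound ⇐ PurityIsSpectralMass (Tr ρ_A² = 2^{−|A|}
Σ_{Q∈𝒫_A}⟨Q⟩², over PauliParseval) → CleaningCount (|𝒫_A ∩ S^⊥| = 4^{|A|}2^{s_Ā−m}, fibres S_A;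
first-passage of |A|−s_A) →
SymplecticPurityBound. DlogGraphFlat ⇐ LightMasksFlat (|b|+|b'| ≤ cn/log n; Gauss sums) →
ShortShiftsFlat (|a|+|a'| ≤ (1/2−δ)n;
XorCoincidenceBound) → HeavyRegime (the open core) → DlogGraphFlat. NoFreeFrame ⇐ CubeFamilyUniform
(IsUniform of the cyclotomic cube
family) → FinalStateIsGraph (stateAfter = |x⟩ ⊗ ĝ ⊗ |0…0⟩) → NoFreeFrame (with cruxes 2–3).

KILL CRITERIA. SymplecticPurityBound refuted AS TYPED → restate (conventions), the inequality is
checked; refuted IN SUBSTANCE (a Clifford frame +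
stabilizer ancillas giving all linear cuts purity ≫ ε for a flat state) → the mechanism is dead,
close `refuted:SymplecticPurityBound`.
CubeGraphFlat cannot fail in substance (exhaustive n ≤ 7); DlogGraphFlat refuted by a structural
resonance family → the Shor transfer
is withdrawn, the route keeps the unconditional kill (drop or restate to typical (p,g));
CompositeFrameBound refuted → recorded as the
reach limit of spectral invariants (drop, card K2 answered negatively); GaussianDegreeBound refuted
as typed → conventions. H_FF PROVED
for uniform families (nobody expects it) → X and ¬S. A proof elsewhere of QuantumAdvantage moots X
but not the kills.

NOT DECOMPOSED YET. The uniform typing of the witness family (CubeFamilyUniform: cyclotomic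
trinomial arithmetic through RevSLP; or Shoup's deterministic
irreducible for all n) and the IsUniform bookkeeping; the ε-robust version of crux 2 (|Tr ρ² − Tr
σ²| ≤ 2‖ρ−σ‖₁, truncation error of
adaptive re-framing pipelines, card K3) and the OPERATOR version for pipelines that never
materialise the data state (Heisenberg-evolved
projector, two-sided frames); the order-finding variant of crux 4 (x over 2n qubits, many periods:
x-only shifts governed by the
AN-code distance of ord_N(a) = ShorLocallyDark's OrderSparseMultiplesRare); ancilla MODES in crux 5
(log loss); Schmidt-rank and
best-rank-χ-approximation corollaries of the purity bounds (rank ≥ 1/Tr ρ², fidelity² ≤ χ·Tr ρ²) —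
provers attach them with --supports.

CHEAPEST FALSIFIER. (i) The counting behind crux 2 on small instances — DONE at planning:
compute/check_frames.py (cube state n=5 ⊗ 1–2 ancillas, 11–12
qubits; identity, ancillas-swapped-to-front, encoding, encode+swap and random depth-80 Clifford
frames): the per-cut bound
2^{−φ} + 2^{n−ψ}ε² held at every cut of every frame, min purity 0.03 ≤ 3ε. (ii)
compute/check_cube.py — DONE: Δ = 2, L = 2^{⌊n/2⌋+1}
for n = 3..7 and the dictionary max_{S≠I}|⟨S⟩| = max(Δ,L) verified over all 4⁶−1 Paulis at n = 3.
(iii) DONE by refuters g41-49 / g41-31 / rreview-0815T14-7 (evidence on 9837: resonance at Mersenne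
and 2ⁿ−3 primes found, n-digit guard vacuous → guard re-typed over n+1 digits): full Pauli spectra
of |x⟩|g^x mod p⟩ for n ≤ 7 off the 2-adic locus — a max_{Q≠I}|⟨Q⟩|·2^{n/2} that grows with n
would push δ in crux 4 towards 0; and the published OFD/OBD disentanglers (arXiv:2412.17209 code) on
|x⟩|x³⟩, n ≤ 10 — bond dimension
must stay ≥ 2^{n/2−3}. (iv) Literature: is 'min over the Clifford orbit of Rényi-2 entanglement ≥ d
− log₂(1+(4^d−1)ε²)' already in
print (Tirrito et al. arXiv:2304.01175 prove the orbit-AVERAGED flatness law; Gu–Oliviero–Leone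
arXiv:2403.19610 the nullity UPPER
bound)? If so crux 2 minus ancillas is `known` and the route's delta shrinks to the cleaning
robustness + the dictionary + the kill.

NUMBERS. Cube map x³ on GF(2ⁿ): Δ = 2 (APN, all n), L = 2^{(n+1)/2} (n odd, almost bent) / 2^{n/2+1}
(n even) — Gold 1968, Nyberg 1993;
checked n = 3..7. Kill strength: every Clifford frame of |x⟩|x³⟩ ⊗ (stabilizer ancillas) has a bond
with Schmidt rank ≥ 2ⁿ/(8√2ⁿ) =
2^{n/2−3} (2n data qubits). Disentangling thresholds in print: t ≲ N − 1.607 T-gates fully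
Clifford-disentanglable on average
(arXiv:2410.09001); OFD exact for t ≤ N (arXiv:2412.17209). Flatness floor: max_{S≠I}|⟨S⟩| ≥
(2ⁿ+1)^{−1/2} for every pure state
(Parseval), so δ ≤ 1/2 and the cube family is optimal up to the factor 2√2. Crux 4 window: p ∈ [2ⁿ −
2^{0.53n}, 2ⁿ), w_NAF(p−1) ≥ n/8
(typical value ≈ 0.18n; so δ ≤ 1/8 is forced by the X-shift family, and the claim is ∃ δ > 0). Items
at open: 10 (1 target, 5 cruxes, 3 support, 1 assembly).

DEFINITION REQUESTS. None blocking: purity of a linear cut, ε-flatness and 'Gaussian unitary' are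
written inline (4-fold agreement sum; max over
pauliString; U·majorana·U† = Σ R • majorana with R Rᵀ = 1) over existing tree declarations (QReg,
tensorVec, zeroState, pauliString, majorana, Matrix.unitaryGroup, QCircuitFamily.stateAfter).
Optional hygiene for a later tenure pass: `cutPurity`, `pauliFlatness`, `IsCliffordUnitary`,
`IsGaussianUnitary` in Literature/Computability/QuantumComplexity (next to QuantumMarginals /
GaussianRank) would shorten five items.

Novelty: Searches (2026-08-15, this session; lit search local/hybrid + searchd + galaxy were DOWN (rc 75 /
connection reset), OpenAlex/S2 HTTP 429
— logged in NOTES.md; arXiv tier worked): `lit search --source arxiv "Clifford augmented matrix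
product states"` (8: 2501.00413,
2510.04164, 2412.17209, 2505.08635, 2407.03202, 2506.16026, 2405.09217, 2411.12683 — the CAMPS
corpus, no lower bound for any explicit
family); `… "stabilizer Renyi entropy entanglement"` (8, incl. 2411.11720, 2406.19457); `…
"disentangling Clifford circuits
nonstabilizerness"` (1: 2410.09001, READ pp.1,36: disentangling theorem for t ≲ N, inextricability
only asked); `… "magic induced
computational separation entanglement"` (3: 2403.19610 READ (nullity distillation = Clifford
compression UPPER bound E ≤ ν),
2510.06318, 2312.00132); `… "nonstabilizerness entanglement spectrum flatness"` (1: 2605.04210); `…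
"Pauli spectrum nonstabilizerness
many-body"` (1); `… "almost perfect nonlinear quantum magic"` (0); `… "magic hypergraph states bent
functions"` (0); `lit galaxy search --star all` for "Clifford-augmented" (1 pdf: 2502.01872
Clifford-dressed TDVP), "almost perfect nonlinear" (6 panama books incl. Carlet 2021 =
panama:326022377504858, the S-box reference; 6 pdf), "stabilizer entropy" (6 pdf: 2304.13768,
2305.15398, …), "matchgate" (6+6, LNCS volumes) — nothing joining S-box nonlinearity to
frame-minimised entanglement; plus the card's
searches (lit read 2412.17209 §6, 2602.15942 Thm III.1, 2411.11720 p.14; hub g  [refs: 2410.09001, 2403.19610, 2602.15942, 2411.11720, 2304.01175, 2308.01886, 1501.07644]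

Barriers (technique_class: simulation-lower-bound, symplectic, tensor-networks): - technique_class: simulation-lower-bound, symplectic, tensor-networks
- Literature.Barriers.QuantumAdvantage.Relativization: not engaged — every item is about explicit
states (S-box / DLOG data-loading vectors) and their Pauli or Majorana spectra, or about free frames
applied to them; an oracle gate has no spectrum to bound and H_FF says nothing about BQP^O; the
collapse direction X is only the shared target (same status as Dequantize:
`Relativization.not_relativizes_collapse_shape` constrains PROOFS of X, and this route expects to
land kills, not X). (ADJACENT catalogue files, not barrier decls: BoundedEntanglement.lean —
Jozsa–Linden `jozsaLinden2003_pblocked`, PROVED in tree, 'p-blocked families decide only BPP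
languages': crux 2 shows the witness states are not p-blocked for any p < 2δn−2 in ANY Clifford
frame with any stabilizer ancillas, i.e. it quantifies 'unbounded entanglement is necessary'
frame-independently — extended, not violated; TensorNetworkContraction.lean — Markov–Shi bounds cost
by treewidth of the CIRCUIT, this route bounds bond dimension of the STATE in every free frame,
consistent; LatticeRigidity.lean — homomorphic linear shadows of the gate group are finite
(`latticeRigidity_finiteImage`), CAMPS-type simulators are state-dependent re-framings, not
homomorphisms, so only a STATE-level invariant such as frame-minimised purity can kill them — which
is what crux 2 supplies.)
- Literature.Barriers.QuantumAdvantage.Algebrization: same verdict (`Algebrizati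

Novelty grade: new-combination — ROUTE REVIEW (refuter rreview-0815T14-7, 2026-08-15; file REVIEW-SymplecticPurity.md on stmt-QuantumAdvantage-9843). Grade new-combination: (flat Pauli spectrum ⇒ entanglement in every Clifford frame, made ancilla-robust by the stabilizer cleaning count — the bare orbit statement is folklore-adjacen (refuter refuter-rreview-0815T14-7-0, 2026-08-15T15:13:54Z; prior: arXiv:2304.01175, arXiv:2403.19610, quant-ph/0406168, arXiv:0810.1983, doi:10.1109/TIT.1968.1054106 (Gold 1968), Nyberg EUROCRYPT93, Chabaud-Vaudenay EUROCRYPT94, Carlet 2021 ch.11, arXiv:0804.4050, arXiv:2412.17209, arXiv:2410.09001, arXiv:2405.09217, arXiv:2505.08635 (CAMPS corpus), JozsaLinden2003)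

History (route lifecycle, newest last):
- 2026-08-15T16:22:30Z · rev 2: restated SymplecticPurityBound (stmt-QuantumAdvantage-9835), CompositeFrameBound (stmt-QuantumAdvantage-9839), NoFreeFrame (stmt-QuantumAdvantage-9842), DlogGraphFlat (stmt-QuantumAdvantage-9837) — cone-repair (planner rrepair-…-g2, 2026-08-15): (a) REROUTED — 9835 SymplecticPurityBound, 9839 CompositeFrameBound (planner-rrepair-QuantumAdvantage-SymplecticPur-7bc776c1-g2-0)
- 2026-08-16T04:15:17Z · AUTO-CRUX (backfill): FFThesis — hypotheses of the deciding theorem that nothing in the route derives are cruxes (operator:999:1085951)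
- 2026-08-16T14:04:28Z · CLOSED retired — retire-with-barriers (human ruling 2026-08-16 'let the X pair go'): proven bounds filed under Literature/Barriers/QuantumAdvantage/NoFreeFrame*.lean; NoFreeFrame refutes the free-frame road (planner-rchoice-QuantumAdvantage-SymplecticPur-64c96483-0)

sub-problem: QuantumAdvantage · status: closed(retired) · opened planner-plancard-QuantumAdvantage-QuantumAdva-ca15b83b-0 2026-08-15T14:31:41Z · rev 3 · ledger route-QuantumAdvantage-SymplecticPurity
GENERATED by the gate from the ledger (D-0016/17). Provers cite these decls: `theorem foo : Summit.QuantumAdvantage.QuantumAdvantage.Theses.SymplecticPurity.<Decl> := …` in Summits/QuantumAdvantage/QuantumAdvantage/Theorems/<Name>.lean.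
-/

namespace Summit.QuantumAdvantage.QuantumAdvantage.Theses.SymplecticPurity

open scoped BigOperators Topology Manifold Classical MeasureTheory ProbabilityTheory Matrix InnerProductSpace ComplexConjugate ContinuousMap
open Filter Set Function TopologicalSpace MeasureTheory

attribute [summit_statement] _root_.QuantumAdvantage

open Literature.QuantumAdvantage

/-- item stmt-QuantumAdvantage-0242 · crux (kind.auto-crux: conjecture-grade) · rank 0 · open · by planner
why it might fail: X puts FACTORING in BPP (Shor) against the oracle evidence BQP^O ⊄ BPP^O (BernsteinVazirani1997 §8); X is expected FALSE — the route exists for the kills of the free-frame road H_FF (NoFreeFrame via SymplecticPurityBound + CubeGraphFlat), not for X.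
sources: BernsteinVazirani1997, Aaronson2010, arXiv:2412.17209, arXiv:2410.09001
Thesis X of route Dequantize, targeting ¬QuantumAdvantage (quantum-advantage.S02, BQP = BPP): every
uniform Clifford+T family with error 1/3 is simulable in BPP. [BernsteinVazirani1997 §8;
BravyiGosset2016] -/
@[route_item "route-QuantumAdvantage-SymplecticPurity"]
def FFThesis : Prop :=
  Literature.Computability.Cryptography.BQP ⊆ Literature.Computability.Complexity.BPP

-- earlier DlogGraphFlat (stmt-QuantumAdvantage-9837, replaced 2026-08-15T16:22:30Z -> stmt-QuantumAdvantage-10732): retired by None — ∃ δ : ℝ, 0 < δ ∧ ∃ n₀ : ℕ, ∀ n ≥ n₀, ∀ p : ℕ, p.Prime → p < 2 ^ n → 2 ^ n ≤ p + 2 ^ (53 * n / 100) → ∀ g : ℕ, orderOf (g : ZMod p) = p - 1 → (∀ c : Fin n → ℤ, (∀ i, c i = 0 ∨ c i = 1 ∨ c i = -1) → ∑ i, c i * 2 ^ (i : ℕ) = (p : ℤ) - 1 → n ≤ 8 * (Finset.univ.filter fun 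
/-- item stmt-QuantumAdvantage-10732 · crux · rank 4 · closed · moot by None · by planner
why it might fail: DECIDING crux; both open cores (stubs dlogDiffBand, dlogWalshTwisted) sit on the √p barrier: band differentials need a power saving over multiplicative binary cubes of size ≈√p (below Bourgain's Π|A_i|>p^{1+δ}), twisted Walsh sums one beyond Pólya–Vinogradov; a sparse g/2-power relation may pin ⟨S⟩.
sources: KonyaginShparlinski1999, BourgainGlibichukKonyagin2006, MauduitRivat2010, BakerHarmanPintz2001, doi:10.1007/s00039-008-0691-6 (Bourgain GAFA 2009: multilinear sums need Π|A_i|>p^{1+δ}, fails in the band), doi:10.1017/s0305004108001230 (Bourgain–Garaev 2009: small-doubling bounds, GP runs of length p^ε only)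
[crux] SHOR TRANSFER — guard REPAIRED 2026-08-15 after refuters g41-49 / g41-31 / rreview-0815T14-7
(evidence on the item: evidence_9837_dlog_not_flat.md, evidence_9837_guard_vacuous.md,
DlogResonance9837.md): the signed digits now range over Fin (n+1), so the guard is the true NAF
weight w(p−1); with digits on Fin n it was VACUOUS for every window prime and the complement
resonance S = X^a ⊗ X^{ā'} (a = supp NAF((p−1)/2), g^{(p−1)/2} = −1, p − y = ȳ − (t−1)) gave ⟨S⟩ =
2^{n−1} exactly at Mersenne p and ≈ 2^{n−2} at p = 2ⁿ − 3. STATEMENT: ∃ δ > 0 ∃ n₀ ∀ n ≥ n₀: for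
every prime p with 2ⁿ − 2^{⌊0.53n⌋} ≤ p < 2ⁿ (Baker–Harman–Pintz window) and every primitive root g
mod p such that p − 1 has NO signed-binary representation Σ_{i≤n} c_i 2^i (c_i ∈ {0,±1}) of weight <
n/8 (off the Pohlig–Hellman / AN-code / complement-resonance locus; Mersenne and 2ⁿ−c with
bit-sparse c+1 are now excluded), the unnormalised DLOG graph vector Σ_{x<2ⁿ} |x⟩|g^x mod p⟩ on n+n
qubits has |⟨S⟩| ≤ 2^{(1−δ)n} for all Pauli strings S ≠ I. Known families: a = 0 ≠ a' vanish; the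
complement-resonance family is ≈ 2^{n+1−w(p−1)−w(s−1)} ≤ 2^{n+1−n/8} under the guard (so any
admissible δ is < 1/8; typical w ≈ 0.18n in t -/
@[route_item "route-QuantumAdvantage-SymplecticPurity"]
def DlogGraphFlat : Prop :=
  ∃ δ : ℝ, 0 < δ ∧ ∃ n₀ : ℕ, ∀ n ≥ n₀, ∀ p : ℕ, p.Prime → p < 2 ^ n → 2 ^ n ≤ p + 2 ^ (53 * n / 100) → ∀ g : ℕ, orderOf (g : ZMod p) = p - 1 → (∀ c : Fin (n + 1) → ℤ, (∀ i, c i = 0 ∨ c i = 1 ∨ c i = -1) → ∑ i, c i * 2 ^ (i : ℕ) = (p : ℤ) - 1 → n ≤ 8 * (Finset.univ.filter fun i => c i ≠ 0).card) → ∀ S : Fin (n + n) → Literature.Computability.QuantumComplexity.Pauli, S ≠ (fun _ => Literature.Computability.QuantumComplexity.Pauli.I) → ‖star (fun w : Literature.Computability.Cryptography.QReg (n + n) => if Nat.ofBits (fun j : Fin n => w (Fin.natAdd n j)) = g ^ Nat.ofBits (fun i : Fin n => w (Fin.castAdd n i)) % p then (1 : ℂ) else 0) ⬝ᵥ (Literature.Computability.QuantumComplexity.pauliString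 S).mulVec (fun w : Literature.Computability.Cryptography.QReg (n + n) => if Nat.ofBits (fun j : Fin n => w (Fin.natAdd n j)) = g ^ Nat.ofBits (fun i : Fin n => w (Fin.castAdd n i)) % p then (1 : ℂ) else 0)‖ ≤ (2 : ℝ) ^ ((1 - δ) * (n : ℝ))

-- earlier CompositeFrameBound (stmt-QuantumAdvantage-9839, replaced 2026-08-15T16:22:30Z -> stmt-QuantumAdvantage-10730): retired by None — ∃ c : ℝ, 0 < c ∧ ∃ n₀ : ℕ, ∀ n ≥ n₀, ∀ (K : Type) [Field K] [Fintype K], Fintype.card K = 2 ^ n → ∀ e : K ≃+ (Fin n → ZMod 2), ∀ C₁ C₂ : Literature.Computability.Cryptography.QCircuit Literature.Computability.Cryptography.cliffordT (n + n), C₁.IsOracleFree → C₁.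
/-- item stmt-QuantumAdvantage-10730 · crux · rank 6 · closed · moot by None · by planner
why it might fail: May be FALSE: Clifford∘Gaussian∘Clifford is no group and has no known invariant; after U the Pauli spectrum is not ℓ∞-flat, so 9835/9838 do not iterate; Clifford-conjugated matchgates on product inputs are already universal-hard (arXiv:2410.10068 Thm 4); one depth-3 disentangler of |x⟩|x³⟩ kills it.
sources: arXiv:2410.10068, arXiv:2505.08635, arXiv:2505.07804, arXiv:2602.15942, arXiv:2412.17209, arXiv:2410.09001
[crux] DEPTH-3 COMPOSITE FRAMES — frames typed semantically (cone repair 2026-08-15). ∃ c > 0 ∃ n₀ ∀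
n ≥ n₀, every field K of order 2ⁿ and additive identification e : K ≃ 𝔽₂ⁿ, all CLIFFORD UNITARIES
U₁, U₂ on n+n qubits (unitary, U σ_S U† = unit phase · σ_{S'} for every Pauli string) and every
fermionic Gaussian unitary U (U c_p U† = Σ_q R_pq c_q with R Rᵀ = 1, c = the tree's Jordan–Wigner
`majorana`): the state U₂ U U₁ ĝ (ĝ = normalised cube graph state Σ_x |x⟩|x³⟩/√2ⁿ) still has a
linear cut of purity ≤ 2^{−cn} — Clifford∘matchgate∘Clifford re-framing (arXiv:2505.08635-type
alternation, depth 2–3) does not compress the almost-bent data state either. Depth 2 is already dead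
quantitatively (refuter g41-31): a pure Gaussian state needs Σ_q M_pq² = 1 in every Majorana row,
but every Clifford conjugate of ĝ has |M_pq| ≤ 2^{1−n/2} over 4n−1 entries, impossible for n ≥ 7;
only genuinely depth-3 disentanglers can refute this. [deps: SymplecticPurityBound,
GaussianDegreeBound] [difficulty: open-problem] -/
@[route_item "route-QuantumAdvantage-SymplecticPurity"]
def CompositeFrameBound : Prop :=
  ∃ c : ℝ, 0 < c ∧ ∃ n₀ : ℕ, ∀ n ≥ n₀, ∀ (K : Type) [Field K] [Fintype K], Fintype.card K = 2 ^ n → ∀ e : K ≃+ (Fin n → ZMod 2), ∀ U₁ U₂ U : Matrix (Literature.Computability.Cryptography.QReg (n + n)) (Literature.Computability.Cryptography.QReg (n + n)) ℂ, U₁ ∈ Matrix.unitaryGroup (Literature.Computability.Cryptography.QReg (n + n)) ℂ → (∀ S : Fin (n + n) → Literature.Computability.QuantumComplexity.Pauli, ∃ S' : Fin (n + n) → Literature.Computability.QuantumComplexity.Pauli, ∃ c : ℂ, ‖c‖ = 1 ∧ U₁ * Literature.Computability.QuantumComplexity.pauliString S * star U₁ = c • Literature.Computability.QuantumComplexity.pauliString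 S') → U₂ ∈ Matrix.unitaryGroup (Literature.Computability.Cryptography.QReg (n + n)) ℂ → (∀ S : Fin (n + n) → Literature.Computability.QuantumComplexity.Pauli, ∃ S' : Fin (n + n) → Literature.Computability.QuantumComplexity.Pauli, ∃ c : ℂ, ‖c‖ = 1 ∧ U₂ * Literature.Computability.QuantumComplexity.pauliString S * star U₂ = c • Literature.Computability.QuantumComplexity.pauliString S') → U ∈ Matrix.unitaryGroup (Literature.Computability.Cryptography.QReg (n + n)) ℂ → (∃ R : Matrix (Fin (n + n) × Bool) (Fin (n + n) × Bool) ℝ, R * Rᵀ = 1 ∧ ∀ p : Fin (n + n) × Bool, U * Literature.Computability.QuantumComplexity.majorana (n + n) p.1 p.2 * star U = ∑ q : Fin (n + n) × Bool, (R p q : ℂ) • Literature.Computability.QuantumComplexity.majorana (n + n) q.1 q.2) → ∃ k ≤ n + n, ‖∑ x₁ : Literature.Computability.Cryptography.QReg (n + n), ∑ x₂ : Literature.Computability.Cryptography.QReg (n + n), ∑ x₃ : Literature.Computability.Cryptography.QReg (n + n), ∑ x₄ : Literature.Computability.Cryptography.QReg (n + n), (if (∀ i, k ≤ i.val → x₁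 i = x₂ i) ∧ (∀ i, i.val < k → x₂ i = x₃ i) ∧ (∀ i, k ≤ i.val → x₃ i = x₄ i) ∧ (∀ i, i.val < k → x₄ i = x₁ i) then (U₂.mulVec (U.mulVec (U₁.mulVec (fun w : Literature.Computability.Cryptography.QReg (n + n) => if (fun j : Fin n => w (Fin.natAdd n j)) = (fun j : Fin n => decide (e ((e.symm (fun i : Fin n => if w (Fin.castAdd n i) then 1 else 0)) ^ 3) j = 1)) then ((Real.sqrt 2 ^ n)⁻¹ : ℂ) else 0)))) x₁ * star ((U₂.mulVec (U.mulVec (U₁.mulVec (fun w : Literature.Computability.Cryptography.QReg (n + n) => if (fun j : Fin n => w (Fin.natAdd n j)) = (fun j : Fin n => decide (e ((e.symm (fun i : Fin n => if w (Fin.castAdd n i) then 1 else 0)) ^ 3) j = 1)) then ((Real.sqrt 2 ^ n)⁻¹ : ℂ) else 0)))) x₂) * (U₂.mulVec (U.mulVec (U₁.mulVec (fun w : Literature.Computability.Cryptography.QReg (n + n) => if (fun j : Fin n => w (Fin.natAdd n j)) = (fun j : Fin n => decide (e ((e.symm (fun i : Fin n => if w (Fin.castAdd n i) then 1 else 0))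 ^ 3) j = 1)) then ((Real.sqrt 2 ^ n)⁻¹ : ℂ) else 0)))) x₃ * star ((U₂.mulVec (U.mulVec (U₁.mulVec (fun w : Literature.Computability.Cryptography.QReg (n + n) => if (fun j : Fin n => w (Fin.natAdd n j)) = (fun j : Fin n => decide (e ((e.symm (fun i : Fin n => if w (Fin.castAdd n i) then 1 else 0)) ^ 3) j = 1)) then ((Real.sqrt 2 ^ n)⁻¹ : ℂ) else 0)))) x₄) else 0)‖ ≤ (2 : ℝ) ^ (-(c * (n : ℝ)))

-- earlier SymplecticPurityBound (stmt-QuantumAdvantage-9835, replaced 2026-08-15T16:22:30Z -> stmt-QuantumAdvantage-10729): retired by None — ∀ (n m : ℕ) (ε : ℝ) (ψ : Literature.Computability.Cryptography.QReg n → ℂ), 1 ≤ n → Literature.Computability.Cryptography.normSq ψ = 1 → (∀ S : Fin n → Literature.Computability.QuantumComplexity.Pauli, S ≠ (fun _ => Literature.Computability.QuantumComplexity.P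
/-- item stmt-QuantumAdvantage-10729 · support · rank 2 · closed · proved by Summit.QuantumAdvantage.QuantumAdvantage.Theorems.SymplecticPurity.SymplecticPurityBound_proof (prover) · by planner
why it might fail: Inequality audited on paper by four refuters and numerically (240/240; all cuts, n ≤ 12); residual risk is conventions — ℂ-valued 4-fold sum under ‖·‖, tensorVec wire order (data first), the phase c in U σ_S U† = c σ_{S'}; the semantic frame set exceeds T-free circuits only by global phases.
sources: arXiv:quant-ph/0406168, arXiv:0810.1983, arXiv:2403.19610, arXiv:2304.01175, arXiv:2409.16895, KempeEtAl2010
[support, load-bearing] ENTANGLEMENT YOU CANNOT ROTATE AWAY — frames typed SEMANTICALLY (cone repair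
2026-08-15). Let ψ be a unit vector on n ≥ 1 qubits with |⟨ψ|S|ψ⟩| ≤ ε for every Pauli string S ≠ I.
For every m and every CLIFFORD UNITARY U on n+m qubits — any unitary with U σ_S U† = c·σ_{S'} (|c| =
1) for every Pauli string S; this contains every T-free oracle-free Clifford+T circuit, every qubit
permutation and every stabilizer-ancilla preparation, and needs neither the gate-set generation
theorem nor the undischarged gate-unitarity facts of QubitRegister — the state U(ψ ⊗ |0^m⟩) has a
LINEAR cut {wires < k} whose purity Tr ρ² (the 4-fold agreement sum) is ≤ 4ε; hence Schmidt rank ≥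
1/(4ε) at that bond. Proof (planner; audited on paper by refuters g41-22, g41-6, g40-4, g41-49 with
constant 3, numerics 240/240 and n ≤ 12): Tr ρ_A² = 2^{-|A|} Σ_{Q∈𝒫_A}⟨Q⟩²; conjugation by U
permutes Pauli strings up to sign (a symplectic map on 𝔽₂^{2(n+m)}); S = U(I⊗𝒵_m)U† is isotropic of
dimension m and |𝒫_A ∩ S^⊥| = 4^{|A|}·2^{s_Ā−m}, so Tr ρ_A² ≤ 2^{s_A−|A|} + 2^{|A|−m+s_Ā}ε²; along
the chain j = |A_k| − s_{A_k} climbs 0 → n by steps ≤ +1 and at j = ⌈log₂ 1/ε⌉ (≤ n since ε ≥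
(2ⁿ+1)^{−1/2}) the -/
@[route_item "route-QuantumAdvantage-SymplecticPurity"]
def SymplecticPurityBound : Prop :=
  ∀ (n m : ℕ) (ε : ℝ) (ψ : Literature.Computability.Cryptography.QReg n → ℂ), 1 ≤ n → Literature.Computability.Cryptography.normSq ψ = 1 → (∀ S : Fin n → Literature.Computability.QuantumComplexity.Pauli, S ≠ (fun _ => Literature.Computability.QuantumComplexity.Pauli.I) → ‖star ψ ⬝ᵥ (Literature.Computability.QuantumComplexity.pauliString S).mulVec ψ‖ ≤ ε) → ∀ U : Matrix (Literature.Computability.Cryptography.QReg (n + m)) (Literature.Computability.Cryptography.QReg (n + m)) ℂ, U ∈ Matrix.unitaryGroup (Literature.Computability.Cryptography.QReg (n + m)) ℂ → (∀ S : Fin (n + m) → Literature.Computability.QuantumComplexity.Pauli, ∃ S' : Fin (n + m) → Literature.Computability.QuantumComplexity.Pauli, ∃ c : ℂ, ‖c‖ = 1 ∧ U * Literature.Computability.QuantumComplexity.pauliString S * star U = c • Literature.Computability.QuantumComplexity.pauliString S') → ∃ k ≤ n + m, ‖∑ x₁ : Literature.Computability.Cryptography.QReg (n + m), ∑ x₂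 : Literature.Computability.Cryptography.QReg (n + m), ∑ x₃ : Literature.Computability.Cryptography.QReg (n + m), ∑ x₄ : Literature.Computability.Cryptography.QReg (n + m), (if (∀ i, k ≤ i.val → x₁ i = x₂ i) ∧ (∀ i, i.val < k → x₂ i = x₃ i) ∧ (∀ i, k ≤ i.val → x₃ i = x₄ i) ∧ (∀ i, i.val < k → x₄ i = x₁ i) then (U.mulVec (Literature.Computability.Cryptography.tensorVec ψ (Literature.Computability.Cryptography.zeroState m))) x₁ * star ((U.mulVec (Literature.Computability.Cryptography.tensorVec ψ (Literature.Computability.Cryptography.zeroState m))) x₂) * (U.mulVec (Literature.Computability.Cryptography.tensorVec ψ (Literature.Computability.Cryptography.zeroState m))) x₃ * star ((U.mulVec (Literature.Computability.Cryptography.tensorVec ψ (Literature.Computability.Cryptography.zeroState m))) x₄) else 0)‖ ≤ 4 * ε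

/-- item stmt-QuantumAdvantage-9836 · support · rank 3 · closed · proved by Summit.QuantumAdvantage.QuantumAdvantage.Theorems.SymplecticPurity.CubeGraphFlat_proof (prover) · by planner
why it might fail: Mathematically classical (APN/AB exponents); zero slack for even n (L = 2^{n/2+1} = 2√2ⁿ exactly), so any convention slip (Bool↔ZMod 2 transport through e, castAdd/natAdd register order, Y-phase signs in pauliString) shows immediately; e additive suffices since additive = 𝔽₂-linear.
sources: doi:10.1109/TIT.1968.1054106, doi:10.1007/3-540-48285-7_6, Carlet2020, book:carlet2020-boolean-functions-cryptography-coding-theory PDF pp.222-223, 497, arXiv:2308.01886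
[crux] THE ALMOST-BENT WITNESS (card K1 made unconditional on an explicit family). For every finite
field K with |K| = 2ⁿ and every additive (= 𝔽₂-linear) identification e : K ≃ 𝔽₂ⁿ, the unnormalised
graph vector g = Σ_x |x⟩|e((e⁻¹x)³)⟩ on n+n qubits satisfies |⟨g|S|g⟩| ≤ 2·√2ⁿ for every Pauli
string S ≠ I (i.e. the normalised data-loading state of the cube map is 2^{1−n/2}-flat). Mechanism:
by GraphStateSpectrum the bound is max(Δ, L) of f = cube; Δ = 2 ((x+a)³+x³ = a x² + a²x + a³ is
2-to-1) and L = 2^{⌊n/2⌋+1} (|W(α,β)|² = 2ⁿ·#{u : u = 0 ∨ βu³ = …} ≤ 2^{n+2}), Gold 1968 / Nyberg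
1993; checked n = 3..7 (compute/check_cube.py: D = 2, L = 4,8,8,16,16 — the bound is tight for even
n). [deps: GraphStateSpectrum, CubeAlmostBent] [difficulty: M] -/
@[route_item "route-QuantumAdvantage-SymplecticPurity"]
def CubeGraphFlat : Prop :=
  ∀ (n : ℕ) (K : Type) [Field K] [Fintype K], Fintype.card K = 2 ^ n → ∀ e : K ≃+ (Fin n → ZMod 2), ∀ S : Fin (n + n) → Literature.Computability.QuantumComplexity.Pauli, S ≠ (fun _ => Literature.Computability.QuantumComplexity.Pauli.I) → ‖star (fun w : Literature.Computability.Cryptography.QReg (n + n) => if (fun j : Fin n => w (Fin.natAdd n j)) = (fun j : Fin n => decide (e ((e.symm (fun i : Fin n => if w (Fin.castAdd n i) then 1 else 0)) ^ 3) j = 1)) then (1 : ℂ) else 0) ⬝ᵥ (Literature.Computability.QuantumComplexity.pauliString S).mulVec (fun w : Literature.Computability.Cryptography.QReg (n + n) => if (fun j : Fin n => w (Fin.natAdd n j)) = (fun j : Fin n => decide (e ((e.symm (fun i : Fin n => if w (Fin.castAdd n i) then 1 else 0)) ^ 3) j = 1)) then (1 : ℂ) else 0)‖ ≤ 2 * Real.sqrt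 2 ^ n

/-- item stmt-QuantumAdvantage-9838 · support · rank 5 · closed · proved by Summit.QuantumAdvantage.QuantumAdvantage.Theorems.SymplecticPurity.GaussianDegreeBound_proof @ abf1f1ec94f9 (prover) · by planner
why it might fail: Bessel per Majorana degree; could fail only through conventions (JW order of `majorana n j b`, star U for U⁻¹, ℂ-cast of R; parity-odd R allowed, harmless); NB with poly(n) ancilla MODES the count degrades to Σ_j C(2n,k−2j)C(m,j), 2^{Ω(n/log n)} — not claimed here.
sources: JozsaMiyake2008, arXiv:0804.4050, arXiv:quant-ph/0108010, DiasKoenig2024, CudbyStrelchuk2023, arXiv:2412.05367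
[crux] MATCHGATE FRAMES (card identity (2)). For a unit ε-flat ψ on n qubits and every fermionic
Gaussian unitary U (U c_p U† = Σ_q R_pq c_q with R Rᵀ = 1, c = the tree's Jordan–Wigner `majorana`),
every initial block of d ≤ n qubits of Uψ has purity ≤ 2^{−d}(1 + ε² Σ_{k=1}^{2d} C(2n,k)): in a
fixed JW frame no matchgate circuit lowers the Rényi-2 entanglement of the first d ≤ c(δ)n qubits of
a 2^{−δn}-flat state below d − 1 (H(d/n) < δ). Proof: U†c_S U = Σ_{|T|=|S|} det(R_{T,S}) c_T
(compound of an orthogonal matrix is orthogonal), Bessel inside each degree, Tr ρ_{[d]}² = 2^{−d}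
Σ_{S ⊆ first 2d modes} ⟨c_S⟩². [difficulty: M] -/
@[route_item "route-QuantumAdvantage-SymplecticPurity"]
def GaussianDegreeBound : Prop :=
  ∀ (n : ℕ) (ε : ℝ) (ψ : Literature.Computability.Cryptography.QReg n → ℂ), Literature.Computability.Cryptography.normSq ψ = 1 → (∀ S : Fin n → Literature.Computability.QuantumComplexity.Pauli, S ≠ (fun _ => Literature.Computability.QuantumComplexity.Pauli.I) → ‖star ψ ⬝ᵥ (Literature.Computability.QuantumComplexity.pauliString S).mulVec ψ‖ ≤ ε) → ∀ U : Matrix (Literature.Computability.Cryptography.QReg n) (Literature.Computability.Cryptography.QReg n) ℂ, U ∈ Matrix.unitaryGroup (Literature.Computability.Cryptography.QReg n) ℂ → (∃ R : Matrix (Fin n × Bool) (Fin n × Bool) ℝ, R * Rᵀ = 1 ∧ ∀ p : Fin n × Bool, U * Literature.Computability.QuantumComplexity.majorana n p.1 p.2 * star U = ∑ q : Fin n × Bool, (R p q : ℂ) • Literature.Computability.QuantumComplexity.majorana n q.1 q.2) → ∀ d ≤ n, ‖∑ x₁ : Literature.Computability.Cryptography.QReg n, ∑ x₂ : Literature.Computability.Cryptography.QReg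 n, ∑ x₃ : Literature.Computability.Cryptography.QReg n, ∑ x₄ : Literature.Computability.Cryptography.QReg n, (if (∀ i, d ≤ i.val → x₁ i = x₂ i) ∧ (∀ i, i.val < d → x₂ i = x₃ i) ∧ (∀ i, d ≤ i.val → x₃ i = x₄ i) ∧ (∀ i, i.val < d → x₄ i = x₁ i) then (U.mulVec ψ) x₁ * star ((U.mulVec ψ) x₂) * (U.mulVec ψ) x₃ * star ((U.mulVec ψ) x₄) else 0)‖ ≤ (1 + ε ^ 2 * ∑ k ∈ Finset.Icc 1 (2 * d), ((2 * n).choose k : ℝ)) / 2 ^ d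

-- earlier NoFreeFrame (stmt-QuantumAdvantage-9842, replaced 2026-08-15T16:22:30Z -> stmt-QuantumAdvantage-10731): retired by None — ¬ (∀ F : Literature.Computability.Cryptography.QCircuitFamily Literature.Computability.Cryptography.cliffordT, F.IsOracleFree → F.IsUniform → ∃ c : ℕ, ∀ x : List Bool, ∀ j : ℕ, ∃ C : Literature.Computability.Cryptography.QCircuit Literature.Computability.Cryptography.cl
/-- item stmt-QuantumAdvantage-10731 · support · rank 9 · closed · proved by Summit.QuantumAdvantage.QuantumAdvantage.Theorems.SymplecticPurity.noFreeFrame_proof (prover) · by planner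
sources: arXiv:2412.17209, arXiv:2405.09217, arXiv:2407.03202, arXiv:quant-ph/0301063, JozsaLinden2003, tree Literature/Barriers/QuantumAdvantage/BoundedEntanglement.lean (stateAfter)
[support] THE COMPLEXITY-LEVEL KILL ¬H_FF — frames typed semantically (cone repair 2026-08-15;
STRONGER than rev 1: H_FF now asks only for SOME Clifford unitary frame, so ¬H_FF must defeat every
element of the Clifford group, which is exactly what SymplecticPurityBound delivers; no
tCount/IsOracleFree on the frame). H_FF (non-uniform, weakest form, purity form): every uniform
oracle-free Clifford+T family F admits c such that for every input x and stage j some Clifford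
unitary U on the |x| + ancillas wires (unitary, U σ_S U† = unit phase · σ_{S'}) gives
U·(F.stateAfter x j) purity ≥ 1/(|x|^c + c) across EVERY linear cut (⟸ polynomial bond dimension in
some Clifford frame and ordering — the representability beneath CAMPS / stabilizer-TN /
Clifford-DMRG). CLAIM: ¬H_FF. Witness (unchanged): F_n loads Σ_y |y⟩ (H on n fresh wires) and
computes y ↦ y³ in 𝔽₂[X]/(X^{2·3^k} + X^{3^k} + 1) (n = 2·3^k; irreducible since 2 is a primitive
root mod 3^{k+1}) with the tree's revCompile (Toffoli = exact Clifford+T) and uncomputed scratch; at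
the final stage the state is |x⟩ ⊗ ĝ ⊗ |0…0⟩, so by SymplecticPurityBound + CubeGraphFlat every
Clifford frame has a cut of purity ≤ 8√2ⁿ/2ⁿ < 1/(n^c + c) for -/
@[route_item "route-QuantumAdvantage-SymplecticPurity"]
def NoFreeFrame : Prop :=
  ¬ (∀ F : Literature.Computability.Cryptography.QCircuitFamily Literature.Computability.Cryptography.cliffordT, F.IsOracleFree → F.IsUniform → ∃ c : ℕ, ∀ x : List Bool, ∀ j : ℕ, ∃ U : Matrix (Literature.Computability.Cryptography.QReg (x.length + F.ancillas x.length)) (Literature.Computability.Cryptography.QReg (x.length + F.ancillas x.length)) ℂ, U ∈ Matrix.unitaryGroup (Literature.Computability.Cryptography.QReg (x.length + F.ancillas x.length)) ℂ ∧ (∀ S : Fin (x.length + F.ancillas x.length) → Literature.Computability.QuantumComplexity.Pauli, ∃ S' : Fin (x.length + F.ancillas x.length) → Literature.Computability.QuantumComplexity.Pauli, ∃ c : ℂ, ‖c‖ = 1 ∧ U * Literature.Computability.QuantumComplexity.pauliString S * star U = c • Literature.Computability.QuantumComplexity.pauliString S') ∧ ∀ k ≤ x.length + F.ancillas x.length,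 (1 : ℝ) / (x.length ^ c + c) ≤ ‖∑ x₁ : Literature.Computability.Cryptography.QReg (x.length + F.ancillas x.length), ∑ x₂ : Literature.Computability.Cryptography.QReg (x.length + F.ancillas x.length), ∑ x₃ : Literature.Computability.Cryptography.QReg (x.length + F.ancillas x.length), ∑ x₄ : Literature.Computability.Cryptography.QReg (x.length + F.ancillas x.length), (if (∀ i, k ≤ i.val → x₁ i = x₂ i) ∧ (∀ i, i.val < k → x₂ i = x₃ i) ∧ (∀ i, k ≤ i.val → x₃ i = x₄ i) ∧ (∀ i, i.val < k → x₄ i = x₁ i) then (U.mulVec (F.stateAfter x j)) x₁ * star ((U.mulVec (F.stateAfter x j)) x₂) * (U.mulVec (F.stateAfter x j)) x₃ * star ((U.mulVec (F.stateAfter x j)) x₄) else 0)‖)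

/-- item stmt-QuantumAdvantage-9840 · support · rank 9 · closed · proved by Summit.QuantumAdvantage.QuantumAdvantage.Theorems.SymplecticPurity.GraphStateSpectrum_proof (prover) · by planner
sources: doi:10.1007/BFb0053450, doi:10.1007/3-540-48285-7_6, KempeEtAl2010, arXiv:2308.01886
[support] THE S-BOX DICTIONARY (provable now, elementary; verified exhaustively for n = 3). For f :
𝔽₂ⁿ → 𝔽₂ⁿ with differential uniformity ≤ D (∀ a ≠ 0, b: #{x : f(x⊕a) ⊕ f(x) = b} ≤ D) and linearity
≤ Λ (∀ β ≠ 0, α: |Σ_x (−1)^{α·x ⊕ β·f(x)}| ≤ Λ), the unnormalised graph vector g_f = Σ_x |x⟩|f(x)⟩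
has |⟨g_f|S|g_f⟩| ≤ max(D, Λ) for every Pauli string S ≠ I: a Pauli with X-part (a,a') pairs |x,f x⟩
with |x⊕a, f(x)⊕a'⟩, non-zero only when f(x⊕a) = f(x)⊕a' (≤ D terms of modulus 1; 0 terms if a = 0 ≠
a'); a Z-type Pauli gives the Walsh sum (≤ Λ, or 0 when β = 0 ≠ α). [difficulty: provable-now] -/
@[route_item "route-QuantumAdvantage-SymplecticPurity"]
def GraphStateSpectrum : Prop :=
  ∀ (n : ℕ) (f : Literature.Computability.Cryptography.QReg n → Literature.Computability.Cryptography.QReg n) (D Λ : ℝ), (∀ a : Literature.Computability.Cryptography.QReg n, a ≠ (fun _ => false) → ∀ b : Literature.Computability.Cryptography.QReg n, ((Finset.univ.filter fun x : Literature.Computability.Cryptography.QReg n => (fun i => Bool.xor (f (fun j => Bool.xor (x j) (a j)) i) (f x i)) = b).card : ℝ) ≤ D) → (∀ β : Literature.Computability.Cryptography.QReg n, β ≠ (fun _ => false) → ∀ α : Literature.Computability.Cryptography.QReg n, |∑ x : Literature.Computability.Cryptography.QReg n, (∏ i, (if α i && x i then (-1 : ℝ) else 1)) * (∏ i, (if β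 i && f x i then (-1 : ℝ) else 1))| ≤ Λ) → ∀ S : Fin (n + n) → Literature.Computability.QuantumComplexity.Pauli, S ≠ (fun _ => Literature.Computability.QuantumComplexity.Pauli.I) → ‖star (fun w : Literature.Computability.Cryptography.QReg (n + n) => if (fun j : Fin n => w (Fin.natAdd n j)) = f (fun i : Fin n => w (Fin.castAdd n i)) then (1 : ℂ) else 0) ⬝ᵥ (Literature.Computability.QuantumComplexity.pauliString S).mulVec (fun w : Literature.Computability.Cryptography.QReg (n + n) => if (fun j : Fin n => w (Fin.natAdd n j)) = f (fun i : Fin n => w (Fin.castAdd n i)) then (1 : ℂ) else 0)‖ ≤ max D Λ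

/-- item stmt-QuantumAdvantage-9841 · support · rank 9 · closed · proved by Summit.QuantumAdvantage.QuantumAdvantage.Theorems.SymplecticPurity.cubeAlmostBent_proof (prover) · by planner
sources: doi:10.1109/TIT.1968.1054106, doi:10.1007/3-540-48285-7_6, doi:10.1023/A:1008344232130, panama:326022377504858 (Carlet 2021, ch. 11), Mathlib Algebra.trace / traceForm_nondegenerate
[support] GOLD/NYBERG FIELD FACTS (provable now over Mathlib): in every finite field K of order 2ⁿ
(as a ZMod 2-algebra), (i) x ↦ x³ is almost perfect nonlinear: ∀ a ≠ 0, b, #{x : (x+a)³ + x³ = b} ≤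
2 (a x² + a² x + a³ = b is quadratic in x); (ii) its component functions are near-bent: ∀ β ≠ 0, α,
|Σ_x (−1)^{Tr(αx + βx³)}| ≤ 2√2ⁿ (square the sum, substitute y = x+u: inner sum = 2ⁿ·[βu + β²u⁴ =
0], at most 4 values of u; trace form non-degenerate). [difficulty: provable-now] -/
@[route_item "route-QuantumAdvantage-SymplecticPurity"]
def CubeAlmostBent : Prop :=
  ∀ (n : ℕ) (K : Type) [Field K] [Fintype K] [Algebra (ZMod 2) K], Fintype.card K = 2 ^ n → (∀ a : K, a ≠ 0 → ∀ b : K, (Finset.univ.filter fun x : K => (x + a) ^ 3 + x ^ 3 = b).card ≤ 2) ∧ (∀ β : K, β ≠ 0 → ∀ α : K, |∑ x : K, (if Algebra.trace (ZMod 2) K (α * x + β * x ^ 3) = 0 then (1 : ℝ) else -1)| ≤ 2 * Real.sqrt 2 ^ n)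

/-- item stmt-QuantumAdvantage-9843 · assembly · rank 1 · closed · proved by Summit.QuantumAdvantage.QuantumAdvantage.Theorems.SymplecticPurity.Assembly_proof (prover) · by planner
sources: BernsteinVazirani1997 §8, Aaronson2010 §1
[assembly] FFThesis → SymplecticPurityBound → CubeGraphFlat → DlogGraphFlat → GaussianDegreeBound →
CompositeFrameBound → GraphStateSpectrum → CubeAlmostBent → NoFreeFrame → ¬QuantumAdvantage. -/
@[route_item "route-QuantumAdvantage-SymplecticPurity"]
def Assembly : Prop :=
  FFThesis → SymplecticPurityBound → CubeGraphFlat → DlogGraphFlat → GaussianDegreeBound → CompositeFrameBound → GraphStateSpectrum → CubeAlmostBent → NoFreeFrame → ¬ QuantumAdvantage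

end Summit.QuantumAdvantage.QuantumAdvantage.Theses.SymplecticPurity
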